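import Summits.BirchSwinnertonDyer.BirchSwinnertonDyer.Theorems.SignedLowerHalvesSmallImageLowerHalfBothSignsRttD2SeqLocalDual
import Summits.BirchSwinnertonDyer.BirchSwinnertonDyer.Theorems.SignedLowerHalvesSmallImageLowerHalfBothSignsRttCharRoadE2DualHomOLinear
import HarnessLib

/-!
# Route `SignedLowerHalves`, crux L `SmallImageLowerHalfBothSigns` (stmt-BirchSwinnertonDyer-23599), line `rtt_w3` v13 — E2, row D2-seq (1′),
# DEFINITIONS posited by the line (part 3/3): the scalar action of `R` on `E^{ε}_{sat,v}`, the `Λ_𝒪 = 𝒪⟦T⟧`-structure of `Q = DQ.X`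
# (`𝒪 = padicCoeffIntegers S`) extending its `Λ`-structure, and the `Λ_𝒪`-LINEARITY of `gX = loc_v^∨`

WIDTH seat `bsd-line-slh-p3-w3` g20 under LEAD `cruxlead-stmt-BirchSwinnertonDyer-23599` g9 (cell `bsd-ssimc`); BRIEF-E2 rev 3.1 `Lines/rtt_w3-BRIEF-E2-g9b.md` §2
rows `Q`, `gX`; sequel of `…RttD2SeqLocalCondition` (part 1) and `…RttD2SeqLocalDual` (part 2). DEFINITIONS WITH BODIES AND PROVED API ONLY — no named fact, no
`sorry`, no instance, no notation; nothing about `λ`, `μ`, freeness or E2 itself is asserted; crux L, crux M, E2 and BSD remain OPEN and are proved for NO curve.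
* §6 `scalarLocalSat a : End(E^{ε}_{sat,v})` (`scalarH1 a` restricted), the ring action `scalarLocalSatRingHom : R →+* End(E^{ε}_{sat,v})`, its commutation with
  `conj_σ` (`conjLocalSat_mul_scalarLocalSat`), and `locSat_scalarH1` (`loc_v` commutes with the scalars — the input `hΦσ` of the LEAD's `dualHom_smul_iwasawaAlgebraO`).
* §7 ★ `LocalCondDualData.exists_moduleO`: for scalars `𝒪 = padicCoeffIntegers S`, `∃ inst : Module (IwasawaAlgebraO S) DQ.X` with (i) `(iwasawaToIwasawaO S f) • x = f • x`
  and (ii) `toDual ((C a) • x) c = toDual x (a · c)` — the LEAD's `exists_moduleO_signedTransportDualDataSat` (p776944) VERBATIM on the local side (tree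
  `IwasawaDualCoeff.exists_module` for `σ = scalarLocalSatRingHom`, `ψ = conj_{γ_v} − 1`, transported along `toDual` by `Function.Injective.module`; (i) by forcing).
  With the LEAD's `isScalarTower_iwasawaAlgebraO_of_smul_eq` this gives the glue's `[Module (IwasawaAlgebraO S) Q] [IsScalarTower Λ Λ_𝒪 Q]`.
* §8 ★ `gXHom_smul_iwasawaAlgebraO`: `gX (F • x) = F • gX x` for all `F ∈ Λ_𝒪`, for ANY pinned `Λ_𝒪`-structures on `Dψ.X` and `DQ.X` (the LEAD's
  `dualHom_smul_iwasawaAlgebraO`, p777222, fed with `locSat_scalarH1`, `locSat_conjSignedSat_sub_one`, the forcing lemmas and the pins); `gXLinearMapO : DQ.X →ₗ[Λ_𝒪] Dψ.X`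
  = the binder `gX` of `charRoad_E2_of_localisation` (p776213).
* §9 consumer conveniences discharging the local binders from the global data: `isOpen_stabilizer_of_hres` (open stabilisers in `Γ_{K_v}`), `exists_isTopGenerator_resGalOfEmb`
  (a local topological generator exists under `AcSigned.IsNonsplitIn`), `smulCommClass_localAction`.
NOT here: `Col` (row (5′)), `z`/`hz`/`ker gX` (row (2′)), `hK` (row (6′)). References: [Kobayashi2003] Thm. 7.3 i); [EmertonPollackWeston2006] §3.1; [GreenbergLNM1716] §1;
[Washington1997] §13.2; [Lang1990] Ch. 5 §1; [NeukirchSchmidtWingberg2008] I.§5.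
-/

set_option autoImplicit false
set_option linter.dupNamespace false -- D-0017: single-problem summit, the namespace repeats the problem name by design
noncomputable section

open scoped Classical
open NumberField IsDedekindDomain Field

universe u

namespace Summit.BirchSwinnertonDyer.BirchSwinnertonDyer.Theorems.SmallImageRttD2Seq

open Literature.NumberTheory.EllipticCurves Literature.NumberTheory.EllipticCurves.Kobayashi2003
  Literature.NumberTheory.EllipticCurves.GreenbergVatsal2000 Literature.NumberTheory.GaloisRepresentations
  Summit.BirchSwinnertonDyer.BirchSwinnertonDyer.Theorems.SmallImageCharSignedSelmer

/-! ## §6. The scalar action of `R` on `E^{ε}_{sat,v}` and its compatibility with `loc_v` -/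

section Scalar

variable {K : Type u} [Field K] [NumberField K] {p : ℕ} [Fact p.Prime] (κ : ZpExtension K p)
  (M : Type u) [AddCommGroup M] [TopologicalSpace M] [DiscreteTopology M]
  (R : Type*) [Ring R] [Module R M]
  (V : WeierstrassCurve K) (j : V.geomPrimaryTorsion p →+ M) (ε : ℤˣ)
  (v : HeightOneSpectrum (𝓞 K)) [DistribMulAction (absoluteGaloisGroup (v.adicCompletion K)) M]
  [SMulCommClass (absoluteGaloisGroup (v.adicCompletion K)) R M]

/-- The scalar `a ∈ R` as an endomorphism of `E^{ε}_{sat,v}` (`scalarH1 a` restricted by `scalarH1_mem_localCondInftySat`): the `R`-structure whose transpose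
gives the constants `C a` of the `R⟦T⟧`-structure of `Q` (§7). [cite: EmertonPollackWeston2006, §3.1] -/
def scalarLocalSat (a : R) : AddMonoid.End (localCondInftySat κ M R V j ε v) :=
  (((GreenbergSelmer.scalarH1 (localSubgroupOfEmb κ.kerSubgroup (closureEmb (K := K) (v.adicCompletion K))) M a).restrict
      (localCondInftySat κ M R V j ε v)).codRestrict (localCondInftySat κ M R V j ε v)
    fun c ↦ scalarH1_mem_localCondInftySat κ M R V j ε v a c.2)

variable {κ M R V j ε v} in
/-- Unfolding `scalarLocalSat`: on classes it is `scalarH1 a` (definitional). [cite: EmertonPollackWeston2006, §3.1] -/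
@[simp] theorem coe_scalarLocalSat_apply (a : R) (c : localCondInftySat κ M R V j ε v) :
    ((scalarLocalSat κ M R V j ε v a c : localCondInftySat κ M R V j ε v) : subgroupH1 (localSubgroupOfEmb κ.kerSubgroup (closureEmb (K := K) (v.adicCompletion K))) M) =
      GreenbergSelmer.scalarH1 (localSubgroupOfEmb κ.kerSubgroup (closureEmb (K := K) (v.adicCompletion K))) M a c :=
  rfl

/-- **The scalars act on `E^{ε}_{sat,v}` through a RING homomorphism `R → End(E^{ε}_{sat,v})`** (`scalarH1_one/_mul/_zero/_add`): the input `σ` of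
the tree's `IwasawaDualCoeff.exists_module`. [cite: EmertonPollackWeston2006, §3.1] -/
def scalarLocalSatRingHom : R →+* AddMonoid.End (localCondInftySat κ M R V j ε v) where
  toFun := scalarLocalSat κ M R V j ε v
  map_one' := by
    refine AddMonoidHom.ext fun c ↦ Subtype.ext ?_
    change GreenbergSelmer.scalarH1 (localSubgroupOfEmb κ.kerSubgroup (closureEmb (K := K) (v.adicCompletion K))) M (1 : R)
        (c : subgroupH1 (localSubgroupOfEmb κ.kerSubgroup (closureEmb (K := K) (v.adicCompletion K))) M) =
      (c : subgroupH1 (localSubgroupOfEmb κ.kerSubgroup (closureEmb (K := K) (v.adicCompletion K))) M)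
    rw [GreenbergSelmer.scalarH1_one, AddMonoidHom.id_apply]
  map_mul' a b := by
    refine AddMonoidHom.ext fun c ↦ Subtype.ext ?_
    change GreenbergSelmer.scalarH1 (localSubgroupOfEmb κ.kerSubgroup (closureEmb (K := K) (v.adicCompletion K))) M (a * b)
        (c : subgroupH1 (localSubgroupOfEmb κ.kerSubgroup (closureEmb (K := K) (v.adicCompletion K))) M) =
      GreenbergSelmer.scalarH1 (localSubgroupOfEmb κ.kerSubgroup (closureEmb (K := K) (v.adicCompletion K))) M a
        (GreenbergSelmer.scalarH1 (localSubgroupOfEmb κ.kerSubgroup (closureEmb (K := K) (v.adicCompletion K))) M b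
          (c : subgroupH1 (localSubgroupOfEmb κ.kerSubgroup (closureEmb (K := K) (v.adicCompletion K))) M))
    rw [GreenbergSelmer.scalarH1_mul, AddMonoidHom.comp_apply]
  map_zero' := by
    refine AddMonoidHom.ext fun c ↦ Subtype.ext ?_
    change GreenbergSelmer.scalarH1 (localSubgroupOfEmb κ.kerSubgroup (closureEmb (K := K) (v.adicCompletion K))) M (0 : R)
        (c : subgroupH1 (localSubgroupOfEmb κ.kerSubgroup (closureEmb (K := K) (v.adicCompletion K))) M) = 0
    rw [GreenbergSelmer.scalarH1_zero, AddMonoidHom.zero_apply]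
  map_add' a b := by
    refine AddMonoidHom.ext fun c ↦ Subtype.ext ?_
    change GreenbergSelmer.scalarH1 (localSubgroupOfEmb κ.kerSubgroup (closureEmb (K := K) (v.adicCompletion K))) M (a + b)
        (c : subgroupH1 (localSubgroupOfEmb κ.kerSubgroup (closureEmb (K := K) (v.adicCompletion K))) M) =
      GreenbergSelmer.scalarH1 (localSubgroupOfEmb κ.kerSubgroup (closureEmb (K := K) (v.adicCompletion K))) M a
          (c : subgroupH1 (localSubgroupOfEmb κ.kerSubgroup (closureEmb (K := K) (v.adicCompletion K))) M) +
        GreenbergSelmer.scalarH1 (localSubgroupOfEmb κ.kerSubgroup (closureEmb (K := K) (v.adicCompletion K))) M b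
          (c : subgroupH1 (localSubgroupOfEmb κ.kerSubgroup (closureEmb (K := K) (v.adicCompletion K))) M)
    rw [GreenbergSelmer.scalarH1_add, AddMonoidHom.add_apply]

variable {κ M R V j ε v} in
/-- Unfolding `scalarLocalSatRingHom` (definitional). [cite: EmertonPollackWeston2006, §3.1] -/
@[simp] theorem scalarLocalSatRingHom_apply (a : R) : scalarLocalSatRingHom κ M R V j ε v a = scalarLocalSat κ M R V j ε v a :=
  rfl

/-- `conj_σ` and the scalars commute on `E^{ε}_{sat,v}` (`GreenbergSelmer.conjH1_comp_scalarH1`). [cite: NeukirchSchmidtWingberg2008, I.§5] -/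
theorem conjLocalSat_mul_scalarLocalSat (σ : absoluteGaloisGroup (v.adicCompletion K)) (a : R) :
    conjLocalSat κ M R V j ε v σ * scalarLocalSat κ M R V j ε v a = scalarLocalSat κ M R V j ε v a * conjLocalSat κ M R V j ε v σ := by
  haveI := normal_localSubgroupOfEmb_kerSubgroup κ v
  refine AddMonoidHom.ext fun c ↦ Subtype.ext ?_
  change ((conjLocalSat κ M R V j ε v σ (scalarLocalSat κ M R V j ε v a c) : localCondInftySat κ M R V j ε v) :
      subgroupH1 (localSubgroupOfEmb κ.kerSubgroup (closureEmb (K := K) (v.adicCompletion K))) M) =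
    ((scalarLocalSat κ M R V j ε v a (conjLocalSat κ M R V j ε v σ c) : localCondInftySat κ M R V j ε v) :
      subgroupH1 (localSubgroupOfEmb κ.kerSubgroup (closureEmb (K := K) (v.adicCompletion K))) M)
  rw [coe_conjLocalSat_apply, coe_scalarLocalSat_apply, coe_scalarLocalSat_apply, coe_conjLocalSat_apply, ← AddMonoidHom.comp_apply,
    GreenbergSelmer.conjH1_comp_scalarH1, AddMonoidHom.comp_apply]

/-- `conj_{γ_v} − 1` commutes with the ring action of the scalars: the input `hcomm` of `IwasawaDualCoeff.exists_module`. [cite: NeukirchSchmidtWingberg2008, I.§5] -/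
theorem conjLocalSat_sub_one_mul_scalarLocalSatRingHom (γv : absoluteGaloisGroup (v.adicCompletion K)) (a : R) :
    (conjLocalSat κ M R V j ε v γv - 1) * scalarLocalSatRingHom κ M R V j ε v a =
      scalarLocalSatRingHom κ M R V j ε v a * (conjLocalSat κ M R V j ε v γv - 1) := by
  rw [scalarLocalSatRingHom_apply, sub_mul, mul_sub, one_mul, mul_one, conjLocalSat_mul_scalarLocalSat]

variable [DistribMulAction (absoluteGaloisGroup K) M] [SMulCommClass (absoluteGaloisGroup K) R M] (S₀ : Set (HeightOneSpectrum (𝓞 K)))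
  (hres : ∀ (σ : absoluteGaloisGroup (v.adicCompletion K)) (m : M), σ • m = resGalOfEmb (closureEmb (K := K) (v.adicCompletion K)) σ • m)
  (hvp : (p : 𝓞 K) ∈ v.asIdeal)

/-- **`loc_v` commutes with the scalars** on the Selmer / local condition groups (`locH1_comp_scalarH1` restricted): the input `hΦσ` of the LEAD's
`dualHom_smul_iwasawaAlgebraO`. [cite: NeukirchSchmidtWingberg2008, I.§5] [cite: EmertonPollackWeston2006, §3.1] -/
theorem locSat_scalarH1 (a : R) (s : signedTransportSelmerInftySat κ M R V j S₀ ε) :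
    locSat κ M R V j S₀ ε v hres hvp ⟨GreenbergSelmer.scalarH1 κ.kerSubgroup M a s, scalarH1_mem_signedTransportSelmerInftySat κ M R V j S₀ ε a s.2⟩ =
      scalarLocalSat κ M R V j ε v a (locSat κ M R V j S₀ ε v hres hvp s) := by
  refine Subtype.ext ?_
  rw [coe_locSat_apply, coe_scalarLocalSat_apply, coe_locSat_apply, ← AddMonoidHom.comp_apply, locH1_comp_scalarH1, AddMonoidHom.comp_apply]

end Scalar

/-! ## §7. The `Λ_𝒪 = 𝒪⟦T⟧`-structure of `Q = DQ.X` (scalars `𝒪 = padicCoeffIntegers S`) -/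

section ModuleO

variable {K : Type u} [Field K] [NumberField K] {p : ℕ} [Fact p.Prime] {κ : ZpExtension K p} {S : Set (PadicAlgCl p)}
  {M : Type u} [AddCommGroup M] [TopologicalSpace M] [DiscreteTopology M] [Module (padicCoeffIntegers S) M]
  {V : WeierstrassCurve K} {j : V.geomPrimaryTorsion p →+ M} {ε : ℤˣ}
  {v : HeightOneSpectrum (𝓞 K)} [DistribMulAction (absoluteGaloisGroup (v.adicCompletion K)) M]
  [SMulCommClass (absoluteGaloisGroup (v.adicCompletion K)) (padicCoeffIntegers S) M]
  {γv : absoluteGaloisGroup (v.adicCompletion K)} (DQ : LocalCondDualData κ M (padicCoeffIntegers S) V j ε v γv)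


/-- ★ **`Q = DQ.X` is a `Λ_𝒪`-module extending its `Λ`-structure, with `C a` the transpose of the scalar `a`.** For a local dual datum `DQ` with scalars
`𝒪 = padicCoeffIntegers S` (`M` `p`-primary with open stabilisers in `Γ_{K_v}` and `𝒪`-linear action, `v` non-split in `K_∞/K`, `γ_v` a local topological generator):
there is a `Module (IwasawaAlgebraO S) DQ.X` such that (i) `(iwasawaToIwasawaO S f) • x = f • x` and (ii) `toDual ((C a) • x) c = toDual x (a · c)` (`scalarLocalSat`).
Construction = the LEAD's `exists_moduleO_signedTransportDualDataSat` (p776944) verbatim on the local side: the tree's `IwasawaDualCoeff.exists_module` on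
`Hom(E^{ε}_{sat,v}, ℚ/ℤ)` for the ring action `scalarLocalSatRingHom` and `ψ = conj_{γ_v} − 1`, transported along the bijection `toDual`; (i) by forcing
(`IwasawaDual.IsLocNil.map_smul_eq_smulFun`, constants of `ℤ_p ⊂ 𝒪` through `ℤ/p^k` by the LEAD's `scalarH1_padicInt_apply_of_pow_smul_eq_zero`). The glue's
`[Module (IwasawaAlgebraO S) Q]` / `[IsScalarTower Λ Λ_𝒪 Q]` (with `isScalarTower_iwasawaAlgebraO_of_smul_eq`). [cite: EmertonPollackWeston2006, §3.1]
[cite: GreenbergLNM1716, §1 (after Conj. 1.3)] -/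
theorem LocalCondDualData.exists_moduleO (htor : ∀ m : M, ∃ k : ℕ, p ^ k • m = 0)
    (hstab : ∀ m : M, IsOpen (MulAction.stabilizer (absoluteGaloisGroup (v.adicCompletion K)) m : Set (absoluteGaloisGroup (v.adicCompletion K))))
    (hv : AcSigned.IsNonsplitIn κ v) (hγv : κ.IsTopGenerator (resGalOfEmb (closureEmb (K := K) (v.adicCompletion K)) γv)) :
    ∃ inst : Module (IwasawaAlgebraO S) DQ.X,
      (∀ (f : IwasawaAlgebra p) (x : DQ.X), (letI := inst; iwasawaToIwasawaO S f • x) = f • x) ∧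
      (∀ (a : padicCoeffIntegers S) (x : DQ.X) (c : localCondInftySat κ M (padicCoeffIntegers S) V j ε v),
        DQ.toDual (letI := inst; (PowerSeries.C a : IwasawaAlgebraO S) • x) c = DQ.toDual x (scalarLocalSat κ M (padicCoeffIntegers S) V j ε v a c)) := by
  have hnil := isLocNil_conjLocalSat_sub_one κ M (padicCoeffIntegers S) V j ε v htor hstab hv hγv
  -- the `𝒪⟦T⟧`-structure on `Hom(E, ℚ/ℤ)`
  obtain ⟨inst₀, -, hX₀, hC₀⟩ := IwasawaDualCoeff.exists_module (σ := scalarLocalSatRingHom κ M (padicCoeffIntegers S) V j ε v)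
    (ψ := conjLocalSat κ M (padicCoeffIntegers S) V j ε v γv - 1)
    (conjLocalSat_sub_one_mul_scalarLocalSatRingHom κ M (padicCoeffIntegers S) V j ε v γv) hnil.nil (AddCircle (1 : ℚ))
  letI := inst₀
  -- transport along `toDual`
  let e : DQ.X ≃+ (localCondInftySat κ M (padicCoeffIntegers S) V j ε v →+ AddCircle (1 : ℚ)) := AddEquiv.ofBijective DQ.toDual DQ.bijective
  letI smulX : SMul (IwasawaAlgebraO S) DQ.X := ⟨fun f x ↦ e.symm (f • e x)⟩
  have hinst : ∀ (f : IwasawaAlgebraO S) (x : DQ.X), DQ.toDual (f • x) = f • DQ.toDual x := fun f x ↦ by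
    change e (e.symm (f • e x)) = f • e x
    rw [e.apply_symm_apply]
  let inst : Module (IwasawaAlgebraO S) DQ.X := Function.Injective.module (IwasawaAlgebraO S) DQ.toDual DQ.bijective.1 hinst
  refine ⟨inst, fun f x ↦ ?_, fun a x c ↦ ?_⟩
  · -- both `Λ`-actions are forced through `toDual`
    apply DQ.bijective.1
    rw [hinst, DQ.toDual_smul_eq_smulFun htor hstab hv hγv f x]
    letI instΛ₀ : Module (IwasawaAlgebra p) (localCondInftySat κ M (padicCoeffIntegers S) V j ε v →+ AddCircle (1 : ℚ)) :=
      Module.compHom _ (iwasawaToIwasawaO S)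
    exact hnil.map_smul_eq_smulFun (X' := localCondInftySat κ M (padicCoeffIntegers S) V j ε v →+ AddCircle (1 : ℚ)) (AddMonoidHom.id _)
      (fun y c ↦ by
        change ((iwasawaToIwasawaO S PowerSeries.X) • y) c = y _
        rw [iwasawaToIwasawaO, PowerSeries.map_X, hX₀])
      (fun a y c k hk ↦ by
        change ((iwasawaToIwasawaO S (PowerSeries.C a)) • y) c = (PadicInt.toZModPow k a).val • y c
        rw [iwasawaToIwasawaO, PowerSeries.map_C, hC₀, ← map_nsmul]
        congr 1
        refine Subtype.ext ?_
        rw [scalarLocalSatRingHom_apply, coe_scalarLocalSat_apply, AddSubgroupClass.coe_nsmul]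
        have hkc : p ^ k • (c : subgroupH1 (localSubgroupOfEmb κ.kerSubgroup (closureEmb (K := K) (v.adicCompletion K))) M) = 0 := by
          rw [← AddSubgroupClass.coe_nsmul, hk, ZeroMemClass.coe_zero]
        exact scalarH1_padicInt_apply_of_pow_smul_eq_zero _ M (padicIntToCoeffIntegers S) a hkc)
      f (DQ.toDual x)
  · rw [hinst, hC₀]
    rfl

end ModuleO

/-! ## §8. `gX = loc_v^∨` is `Λ_𝒪`-linear -/

section TransposeO

variable {K : Type u} [Field K] [NumberField K] {p : ℕ} [Fact p.Prime] {κ : ZpExtension K p} {γ : absoluteGaloisGroup K}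
  (S : Set (PadicAlgCl p)) [FiniteDimensional ℚ_[p] (padicCoeffField S)]
  {M : Type u} [AddCommGroup M] [DistribMulAction (absoluteGaloisGroup K) M] [TopologicalSpace M] [DiscreteTopology M]
  [Module (padicCoeffIntegers S) M] [SMulCommClass (absoluteGaloisGroup K) (padicCoeffIntegers S) M]
  {V : WeierstrassCurve K} {j : V.geomPrimaryTorsion p →+ M} {S₀ : Set (HeightOneSpectrum (𝓞 K))} {ε : ℤˣ}
  (D : SignedTransportDualDataSat κ γ M (padicCoeffIntegers S) V j S₀ ε)
  {v : HeightOneSpectrum (𝓞 K)} [DistribMulAction (absoluteGaloisGroup (v.adicCompletion K)) M]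
  [SMulCommClass (absoluteGaloisGroup (v.adicCompletion K)) (padicCoeffIntegers S) M]
  {γv : absoluteGaloisGroup (v.adicCompletion K)} (DQ : LocalCondDualData κ M (padicCoeffIntegers S) V j ε v γv)
  (hres : ∀ (σ : absoluteGaloisGroup (v.adicCompletion K)) (m : M), σ • m = resGalOfEmb (closureEmb (K := K) (v.adicCompletion K)) σ • m)
  (hvp : (p : 𝓞 K) ∈ v.asIdeal)

/-- ★ **`gX = loc_v^∨` is `Λ_𝒪`-linear** for ANY `Λ_𝒪`-structures `instX` on `Dψ.X` and `instQ` on `DQ.X` carrying the two pins of the LEAD's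
`exists_moduleO_signedTransportDualDataSat` / of `LocalCondDualData.exists_moduleO` (`(ι f)•x = f•x`, `toDual ((C a)•x) = toDual x ∘ (a ·)`): the LEAD's
`dualHom_smul_iwasawaAlgebraO` fed with `locSat_scalarH1` (`hΦσ`), `locSat_conjSignedSat_sub_one` (`hΦψ`), the two forcing lemmas and the pins.
[cite: GreenbergLNM1716, §1 (after Conj. 1.3)] [cite: Washington1997, §13.2] -/
theorem gXHom_smul_iwasawaAlgebraO (instX : Module (IwasawaAlgebraO S) D.X) (instQ : Module (IwasawaAlgebraO S) DQ.X)
    (hιX : ∀ (f : IwasawaAlgebra p) (x : D.X), (letI := instX; iwasawaToIwasawaO S f • x) = f • x)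
    (hιQ : ∀ (f : IwasawaAlgebra p) (x : DQ.X), (letI := instQ; iwasawaToIwasawaO S f • x) = f • x)
    (hCX : ∀ (a : padicCoeffIntegers S) (x : D.X) (s : signedTransportSelmerInftySat κ M (padicCoeffIntegers S) V j S₀ ε),
      D.toDual (letI := instX; (PowerSeries.C a : IwasawaAlgebraO S) • x) s =
        D.toDual x ⟨GreenbergSelmer.scalarH1 κ.kerSubgroup M a s, scalarH1_mem_signedTransportSelmerInftySat κ M (padicCoeffIntegers S) V j S₀ ε a s.2⟩)
    (hCQ : ∀ (a : padicCoeffIntegers S) (x : DQ.X) (c : localCondInftySat κ M (padicCoeffIntegers S) V j ε v),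
      DQ.toDual (letI := instQ; (PowerSeries.C a : IwasawaAlgebraO S) • x) c = DQ.toDual x (scalarLocalSat κ M (padicCoeffIntegers S) V j ε v a c))
    (htor : ∀ m : M, ∃ k : ℕ, p ^ k • m = 0)
    (hstabK : ∀ m : M, IsOpen (MulAction.stabilizer (absoluteGaloisGroup K) m : Set (absoluteGaloisGroup K)))
    (hstab : ∀ m : M, IsOpen (MulAction.stabilizer (absoluteGaloisGroup (v.adicCompletion K)) m : Set (absoluteGaloisGroup (v.adicCompletion K))))
    (hγ : κ.IsTopGenerator γ) (hv : AcSigned.IsNonsplitIn κ v) (hγv : κ.IsTopGenerator (resGalOfEmb (closureEmb (K := K) (v.adicCompletion K)) γv))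
    (F : IwasawaAlgebraO S) (x : DQ.X) :
    letI := instX; letI := instQ
    gXHom D DQ hres hvp (F • x) = F • gXHom D DQ hres hvp x := by
  letI := instX; letI := instQ
  exact SmallImageRttCharRoad.dualHom_smul_iwasawaAlgebraO S D.toDual D.bijective DQ.toDual
    (locSat κ M (padicCoeffIntegers S) V j S₀ ε v hres hvp)
    (isLocNil_conjSignedSat_sub_one κ (padicCoeffIntegers S) V j S₀ ε htor hstabK hγ)
    (isLocNil_conjLocalSat_sub_one κ M (padicCoeffIntegers S) V j ε v htor hstab hv hγv)
    (fun f y ↦ toDual_smul_eq_smulFun D htor hstabK hγ f y) (fun f y ↦ DQ.toDual_smul_eq_smulFun htor hstab hv hγv f y) hιX hιQ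
    (fun a ↦ ((GreenbergSelmer.scalarH1 κ.kerSubgroup M a).comp (signedTransportSelmerInftySat κ M (padicCoeffIntegers S) V j S₀ ε).subtype).codRestrict
      (signedTransportSelmerInftySat κ M (padicCoeffIntegers S) V j S₀ ε)
      fun s ↦ scalarH1_mem_signedTransportSelmerInftySat κ M (padicCoeffIntegers S) V j S₀ ε a s.2)
    (fun a ↦ scalarLocalSat κ M (padicCoeffIntegers S) V j ε v a) hCX hCQ
    (fun s ↦ locSat_conjSignedSat_sub_one hres hvp hγ hγv s)
    (fun a s ↦ locSat_scalarH1 κ M (padicCoeffIntegers S) V j ε v S₀ hres hvp a s) F x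

/-- **`gX` as a `Λ_𝒪`-LINEAR map `Q →ₗ[Λ_𝒪] Dψ.X`** — the binder `gX` of `charRoad_E2_of_localisation` (p776213), under pinned `Λ_𝒪`-structures on `Dψ.X` and
`Q = DQ.X`. [cite: Kobayashi2003, Thm. 7.3 i)] [cite: GreenbergLNM1716, §1 (after Conj. 1.3)] -/
def gXLinearMapO (instX : Module (IwasawaAlgebraO S) D.X) (instQ : Module (IwasawaAlgebraO S) DQ.X)
    (hιX : ∀ (f : IwasawaAlgebra p) (x : D.X), (letI := instX; iwasawaToIwasawaO S f • x) = f • x)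
    (hιQ : ∀ (f : IwasawaAlgebra p) (x : DQ.X), (letI := instQ; iwasawaToIwasawaO S f • x) = f • x)
    (hCX : ∀ (a : padicCoeffIntegers S) (x : D.X) (s : signedTransportSelmerInftySat κ M (padicCoeffIntegers S) V j S₀ ε),
      D.toDual (letI := instX; (PowerSeries.C a : IwasawaAlgebraO S) • x) s =
        D.toDual x ⟨GreenbergSelmer.scalarH1 κ.kerSubgroup M a s, scalarH1_mem_signedTransportSelmerInftySat κ M (padicCoeffIntegers S) V j S₀ ε a s.2⟩)
    (hCQ : ∀ (a : padicCoeffIntegers S) (x : DQ.X) (c : localCondInftySat κ M (padicCoeffIntegers S) V j ε v),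
      DQ.toDual (letI := instQ; (PowerSeries.C a : IwasawaAlgebraO S) • x) c = DQ.toDual x (scalarLocalSat κ M (padicCoeffIntegers S) V j ε v a c))
    (htor : ∀ m : M, ∃ k : ℕ, p ^ k • m = 0)
    (hstabK : ∀ m : M, IsOpen (MulAction.stabilizer (absoluteGaloisGroup K) m : Set (absoluteGaloisGroup K)))
    (hstab : ∀ m : M, IsOpen (MulAction.stabilizer (absoluteGaloisGroup (v.adicCompletion K)) m : Set (absoluteGaloisGroup (v.adicCompletion K))))
    (hγ : κ.IsTopGenerator γ) (hv : AcSigned.IsNonsplitIn κ v) (hγv : κ.IsTopGenerator (resGalOfEmb (closureEmb (K := K) (v.adicCompletion K)) γv)) :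
    letI := instX; letI := instQ
    DQ.X →ₗ[IwasawaAlgebraO S] D.X :=
  letI := instX; letI := instQ
  { toFun := gXHom D DQ hres hvp
    map_add' := map_add _
    map_smul' := fun F x ↦ gXHom_smul_iwasawaAlgebraO S D DQ hres hvp instX instQ hιX hιQ hCX hCQ htor hstabK hstab hγ hv hγv F x }

/-- `gXLinearMapO` is `gXHom` on elements. [cite: Kobayashi2003, Thm. 7.3 i)] -/
theorem gXLinearMapO_apply (instX : Module (IwasawaAlgebraO S) D.X) (instQ : Module (IwasawaAlgebraO S) DQ.X)
    (hιX : ∀ (f : IwasawaAlgebra p) (x : D.X), (letI := instX; iwasawaToIwasawaO S f • x) = f • x)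
    (hιQ : ∀ (f : IwasawaAlgebra p) (x : DQ.X), (letI := instQ; iwasawaToIwasawaO S f • x) = f • x)
    (hCX : ∀ (a : padicCoeffIntegers S) (x : D.X) (s : signedTransportSelmerInftySat κ M (padicCoeffIntegers S) V j S₀ ε),
      D.toDual (letI := instX; (PowerSeries.C a : IwasawaAlgebraO S) • x) s =
        D.toDual x ⟨GreenbergSelmer.scalarH1 κ.kerSubgroup M a s, scalarH1_mem_signedTransportSelmerInftySat κ M (padicCoeffIntegers S) V j S₀ ε a s.2⟩)
    (hCQ : ∀ (a : padicCoeffIntegers S) (x : DQ.X) (c : localCondInftySat κ M (padicCoeffIntegers S) V j ε v),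
      DQ.toDual (letI := instQ; (PowerSeries.C a : IwasawaAlgebraO S) • x) c = DQ.toDual x (scalarLocalSat κ M (padicCoeffIntegers S) V j ε v a c))
    (htor : ∀ m : M, ∃ k : ℕ, p ^ k • m = 0)
    (hstabK : ∀ m : M, IsOpen (MulAction.stabilizer (absoluteGaloisGroup K) m : Set (absoluteGaloisGroup K)))
    (hstab : ∀ m : M, IsOpen (MulAction.stabilizer (absoluteGaloisGroup (v.adicCompletion K)) m : Set (absoluteGaloisGroup (v.adicCompletion K))))
    (hγ : κ.IsTopGenerator γ) (hv : AcSigned.IsNonsplitIn κ v) (hγv : κ.IsTopGenerator (resGalOfEmb (closureEmb (K := K) (v.adicCompletion K)) γv))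
    (x : DQ.X) :
    gXLinearMapO S D DQ hres hvp instX instQ hιX hιQ hCX hCQ htor hstabK hstab hγ hv hγv x = gXHom D DQ hres hvp x :=
  rfl

end TransposeO

/-! ## §9. Discharging the local binders from the global data (consumer conveniences) -/

section Binders

variable {K : Type u} [Field K] [NumberField K] {p : ℕ} [Fact p.Prime] (κ : ZpExtension K p)
  (M : Type u) [AddCommGroup M] [DistribMulAction (absoluteGaloisGroup K) M]
  (v : HeightOneSpectrum (𝓞 K)) [DistribMulAction (absoluteGaloisGroup (v.adicCompletion K)) M]

/-- **Open stabilisers descend to `Γ_{K_v}`**: if the points of `M` have open stabilisers in `Γ_K`, they have open stabilisers for any `Γ_{K_v}`-action pinned by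
`hres` (preimage under the continuous `res_ι`) — the binder `hstab` of parts 2–3 from the global one. [cite: SerreGaloisCohomology1997, II.§1.1] -/
theorem isOpen_stabilizer_of_hres
    (hres : ∀ (σ : absoluteGaloisGroup (v.adicCompletion K)) (m : M), σ • m = resGalOfEmb (closureEmb (K := K) (v.adicCompletion K)) σ • m)
    (hstabK : ∀ m : M, IsOpen (MulAction.stabilizer (absoluteGaloisGroup K) m : Set (absoluteGaloisGroup K))) (m : M) :
    IsOpen (MulAction.stabilizer (absoluteGaloisGroup (v.adicCompletion K)) m : Set (absoluteGaloisGroup (v.adicCompletion K))) := by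
  have heq : (MulAction.stabilizer (absoluteGaloisGroup (v.adicCompletion K)) m : Set (absoluteGaloisGroup (v.adicCompletion K))) =
      resGalOfEmb (closureEmb (K := K) (v.adicCompletion K)) ⁻¹'
        (MulAction.stabilizer (absoluteGaloisGroup K) m : Set (absoluteGaloisGroup K)) := by
    ext σ
    simp only [SetLike.mem_coe, MulAction.mem_stabilizer_iff, Set.mem_preimage, hres]
  rw [heq]
  exact (hstabK m).preimage (resGalOfEmb (closureEmb (K := K) (v.adicCompletion K))).continuous

omit [DistribMulAction (absoluteGaloisGroup K) M] [DistribMulAction (absoluteGaloisGroup (v.adicCompletion K)) M] in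
/-- **A local topological generator exists** when `v` is non-split in `K_∞/K`: some `γ_v ∈ Γ_{K_v}` has `κ(res_ι γ_v) = 1 ∈ ℤ_p` (surjectivity of `κ ∘ res_ι`,
`AcSigned.IsNonsplitIn`) — the binder `γ_v`/`hγv` of parts 2–3. [cite: HatleyLeiVigni2022, §3.1 (`Gal(K_{∞,v}/K_v) = G_∞`)] -/
theorem exists_isTopGenerator_resGalOfEmb (hv : AcSigned.IsNonsplitIn κ v) :
    ∃ γv : absoluteGaloisGroup (v.adicCompletion K), κ.IsTopGenerator (resGalOfEmb (closureEmb (K := K) (v.adicCompletion K)) γv) :=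
  hv (Multiplicative.ofAdd 1)

omit [DistribMulAction (absoluteGaloisGroup (v.adicCompletion K)) M] in
/-- For the canonical filler `localAction`, the `Γ_{K_v}`-action commutes with any scalars commuting with `Γ_K` — the binder
`[SMulCommClass (absoluteGaloisGroup K_v) R M]` of parts 1–3. [cite: EmertonPollackWeston2006, §3.1] -/
theorem smulCommClass_localAction {R : Type*} [SMul R M] [SMulCommClass (absoluteGaloisGroup K) R M] :
    letI := localAction (closureEmb (K := K) (v.adicCompletion K)) M
    SMulCommClass (absoluteGaloisGroup (v.adicCompletion K)) R M :=
  letI := localAction (closureEmb (K := K) (v.adicCompletion K)) M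
  ⟨fun σ r m ↦ smul_comm (resGalOfEmb (closureEmb (K := K) (v.adicCompletion K)) σ) r m⟩

end Binders

end Summit.BirchSwinnertonDyer.BirchSwinnertonDyer.Theorems.SmallImageRttD2Seq

end
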